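import Literature.AlgebraicTopology.FundamentalGroup.PuncturedTorusSlitTori
import Mathlib.Topology.UrysohnsLemma
import Mathlib.Topology.Separation.Connected
import Mathlib.Analysis.SpecialFunctions.Complex.Circle
import HarnessLib

/-!
# Shear alignment of a finite subset of the torus, and the slit torus as a punctured disc

Topic `Literature/AlgebraicTopology/FundamentalGroup`.  Two topological tools for the computation of
the fundamental group of the real `2`-torus `T = (ℝ/ℤ)^ι` (exactly two indices `i₀ ≠ i₁`, the tree's
model `ι → AddCircle 1`, topologically the complex tori `ComplexTorus Φ`) minus a FINITE set `S`
(`TorusMinusFiniteFundamentalGroup.lean`; A. Hatcher, *Algebraic Topology* (2002), §1.2, Example 1.22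
and the discussion after Thm. 1.20 — a punctured surface deformation retracts onto a wedge of circles,
so its `π₁` is free; here van Kampen's theorem is applied directly after moving the punctures into a
convenient position):

* `TorusMinusFinite.exists_homeomorph_forall_apply_eq` — **alignment**: for every finite `S ⊆ T` and
  `c ∈ ℝ/ℤ` there is a self-homeomorphism `Ψ` of `T` with `(Ψ s) i₁ = c` for all `s ∈ S` (all the
  punctures on ONE horizontal circle, hence with pairwise distinct abscissae).  `Ψ` is a composite of
  two SHEARS `p ↦ p - g(p j)·e_i` along continuous maps `g : ℝ/ℤ → ℝ/ℤ` (homeomorphisms of `T`):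
  the first makes the abscissae of `S` pairwise distinct (`exists_rowShift_injOn`: the shift of each
  row is chosen off finitely many forbidden values, `ℝ/ℤ` being infinite; the values are interpolated
  by a continuous map, `exists_continuousMap_addCircle_forall_eq`, Urysohn), the second levels the
  heights.
* `TorusMinusFinite.nonempty_homeomorph_coordNe_ball_diff` — **the slit torus is a punctured disc**:
  `{p | p i₀ ≠ a} ≃ₜ 𝔻 ∖ {0}` by polar coordinates `p ↦ u(p)·e^{2πi p i₁}`, `u(p) ∈ (0,1)` the lift of
  `p i₀ - a` (Mathlib's `AddCircle.equivIco`, `AddCircle.homeomorphCircle`).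

Everything is proved; no definitions (the homeomorphisms are produced as `∃`/`Nonempty` statements and
built inside the proofs), no instances, no named facts.  Classical; support for the abc-iut cell's
campaign-L geometric column (type `(1, r)` curves), nothing here bears on [IUTchIII] Cor. 3.12.

## References
* A. Hatcher, *Algebraic Topology*, CUP (2002), §1.2 Thm. 1.20, Example 1.22 (p. 51). [HatcherAT2002]
-/

noncomputable section

open Set Function

namespace Literature.AlgebraicTopology.FundamentalGroup

namespace TorusMinusFinite

/-! ### §1 Continuous interpolation at finitely many points -/

/-- **Continuous interpolation**: on a normal `T₁` space, finitely many prescribed real values are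
taken by a continuous function (induction on the finite set with Urysohn functions).
[cite: HatcherAT2002, §1.2 (method; folklore)] -/
theorem exists_continuousMap_forall_eq {X : Type*} [TopologicalSpace X] [NormalSpace X]
    [T1Space X] (A : Finset X) (w : X → ℝ) : ∃ G : C(X, ℝ), ∀ a ∈ A, G a = w a := by
  classical
  induction A using Finset.induction_on with
  | empty => exact ⟨0, fun a ha => absurd ha (Finset.notMem_empty a)⟩
  | insert a A haA ih =>
    obtain ⟨G, hG⟩ := ih
    obtain ⟨ψ, hψ0, hψ1, -⟩ := exists_continuous_zero_one_of_isClosed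
      (A.finite_toSet.isClosed) (isClosed_singleton (x := a))
      (Set.disjoint_singleton_right.2 fun h => haA (Finset.mem_coe.1 h))
    refine ⟨G + (w a - G a) • ψ, fun b hb => ?_⟩
    rcases Finset.mem_insert.1 hb with rfl | hb
    · have h1 : ψ b = 1 := hψ1 (Set.mem_singleton b)
      simp [h1]
    · have h0 : ψ b = 0 := hψ0 (Finset.mem_coe.2 hb)
      simp [h0, hG b hb]

/-- Continuous interpolation with values in the circle `ℝ/ℤ` (lift the values to `ℝ`, interpolate,
project). [cite: HatcherAT2002, §1.2 (method; folklore)] -/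
theorem exists_continuousMap_addCircle_forall_eq (A : Finset (AddCircle (1 : ℝ)))
    (v : AddCircle (1 : ℝ) → AddCircle (1 : ℝ)) :
    ∃ g : C(AddCircle (1 : ℝ), AddCircle (1 : ℝ)), ∀ a ∈ A, g a = v a := by
  obtain ⟨G, hG⟩ := exists_continuousMap_forall_eq A
    (fun a => (AddCircle.equivIco (1 : ℝ) 0 (v a) : ℝ))
  refine ⟨⟨fun x => ((G x : ℝ) : AddCircle (1 : ℝ)),
    (AddCircle.continuous_mk' (1 : ℝ)).comp G.continuous⟩, fun a ha => ?_⟩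
  change ((G a : ℝ) : AddCircle (1 : ℝ)) = v a
  rw [hG a ha]
  exact AddCircle.coe_equivIco

/-! ### §2 The torus with two indices: shears and alignment -/

/-- With exactly two indices a point of the torus is determined by its two coordinates.
[cite: HatcherAT2002, §1.2 Example 1.22 (setting)] -/
theorem ext_two {ι : Type*} {i₀ i₁ : ι} (hι : ∀ i, i = i₀ ∨ i = i₁) {p q : ι → AddCircle (1 : ℝ)}
    (h₀ : p i₀ = q i₀) (h₁ : p i₁ = q i₁) : p = q :=
  funext fun i => by rcases hι i with rfl | rfl <;> assumption

/-- The circle `ℝ/ℤ` is infinite (a nontrivial connected `T₁` space).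
[cite: HatcherAT2002, §1.1 Thm. 1.7 (setting; folklore)] -/
theorem infinite_addCircle : Infinite (AddCircle (1 : ℝ)) := by
  haveI : Nontrivial (AddCircle (1 : ℝ)) := ⟨⟨_, 0, PuncturedTorus.half_ne_zero⟩⟩
  exact PreconnectedSpace.infinite

variable {ι : Type*} [DecidableEq ι] {i₀ i₁ : ι}

omit [DecidableEq ι] in
/-- **Row shifts making the abscissae distinct.**  For a finite `S ⊆ T` there is a function `v` on
`ℝ/ℤ` such that `p ↦ p i₀ - v (p i₁)` is injective on `S`: two points of `S` in the same row
(`p i₁ = p' i₁`) already have different abscissae, and the shift of each new row is chosen off the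
finitely many values producing a collision with the rows already treated.
[cite: HatcherAT2002, §1.2 Example 1.22 (method; folklore)] -/
theorem exists_rowShift_injOn (hι : ∀ i, i = i₀ ∨ i = i₁) {S : Set (ι → AddCircle (1 : ℝ))}
    (hS : S.Finite) :
    ∃ v : AddCircle (1 : ℝ) → AddCircle (1 : ℝ), S.InjOn fun p => p i₀ - v (p i₁) := by
  classical
  suffices key : ∀ A : Finset (AddCircle (1 : ℝ)), ∃ v : AddCircle (1 : ℝ) → AddCircle (1 : ℝ),
      ∀ s ∈ S, ∀ s' ∈ S, s i₁ ∈ A → s' i₁ ∈ A →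
        s i₀ - v (s i₁) = s' i₀ - v (s' i₁) → s = s' by
    obtain ⟨v, hv⟩ := key (hS.toFinset.image fun s => s i₁)
    exact ⟨v, fun s hs s' hs' h => hv s hs s' hs'
      (Finset.mem_image_of_mem _ (hS.mem_toFinset.2 hs))
      (Finset.mem_image_of_mem _ (hS.mem_toFinset.2 hs')) h⟩
  intro A
  induction A using Finset.induction_on with
  | empty => exact ⟨fun _ => 0, fun s _ s' _ h => absurd h (Finset.notMem_empty _)⟩
  | insert a A haA ih =>
    obtain ⟨v, hv⟩ := ih
    -- the finitely many forbidden shifts for the new row `a`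
    set B : Set (AddCircle (1 : ℝ)) :=
      (fun q : (ι → AddCircle (1 : ℝ)) × (ι → AddCircle (1 : ℝ)) =>
        q.1 i₀ - q.2 i₀ + v (q.2 i₁)) '' S ×ˢ S with hB
    have hBfin : B.Finite := (hS.prod hS).image _
    haveI := infinite_addCircle
    obtain ⟨x, hxB⟩ := hBfin.infinite_compl.nonempty
    have hxB' : ∀ s ∈ S, ∀ s' ∈ S, x ≠ s i₀ - s' i₀ + v (s' i₁) := fun s hs s' hs' hx =>
      hxB ⟨(s, s'), Set.mk_mem_prod hs hs', hx.symm⟩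
    refine ⟨Function.update v a x, fun s hs s' hs' hsA hs'A h => ?_⟩
    by_cases h1 : s i₁ = a <;> by_cases h2 : s' i₁ = a
    · rw [h1, h2] at h
      exact ext_two hι (sub_left_injective h) (h1.trans h2.symm)
    · rw [h1, Function.update_self, Function.update_of_ne h2] at h
      refine absurd ?_ (hxB' s hs s' hs')
      have h' : x = s i₀ - (s' i₀ - v (s' i₁)) := by rw [← h, sub_sub_cancel]
      rw [h']; abel
    · rw [h2, Function.update_self, Function.update_of_ne h1] at h
      refine absurd ?_ (hxB' s' hs' s hs)
      have h' : x = s' i₀ - (s i₀ - v (s i₁)) := by rw [h, sub_sub_cancel]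
      rw [h']; abel
    · rw [Function.update_of_ne h1, Function.update_of_ne h2] at h
      exact hv s hs s' hs' ((Finset.mem_insert.1 hsA).resolve_left h1)
        ((Finset.mem_insert.1 hs'A).resolve_left h2) h

/-- **Shears of the torus are homeomorphisms**: for `i ≠ j` and a continuous `g : ℝ/ℤ → ℝ/ℤ`,
`p ↦ p - g(p j)·e_i` is a self-homeomorphism of `T` (inverse `p ↦ p + g(p j)·e_i`).
[cite: HatcherAT2002, §1.2 Example 1.22 (method; folklore)] -/
theorem exists_homeomorph_shear {i j : ι} (hij : i ≠ j)
    (g : C(AddCircle (1 : ℝ), AddCircle (1 : ℝ))) :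
    ∃ Φ : (ι → AddCircle (1 : ℝ)) ≃ₜ (ι → AddCircle (1 : ℝ)),
      ∀ p, Φ p = Function.update p i (p i - g (p j)) := by
  refine ⟨{ toFun := fun p => Function.update p i (p i - g (p j))
            invFun := fun p => Function.update p i (p i + g (p j))
            left_inv := fun p => ?_
            right_inv := fun p => ?_
            continuous_toFun := continuous_id.update i
              ((continuous_apply i).sub (g.continuous.comp (continuous_apply j)))
            continuous_invFun := continuous_id.update i
              ((continuous_apply i).add (g.continuous.comp (continuous_apply j))) },
    fun p => rfl⟩
  · simp only [Function.update_self, Function.update_of_ne hij.symm, Function.update_idem,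
      sub_add_cancel, Function.update_eq_self]
  · simp only [Function.update_self, Function.update_of_ne hij.symm, Function.update_idem,
      add_sub_cancel_right, Function.update_eq_self]

/-- **Alignment of a finite set of punctures.**  For `T = (ℝ/ℤ)^ι` with two indices `i₀ ≠ i₁`, a
finite `S ⊆ T` and `c ∈ ℝ/ℤ`, some self-homeomorphism `Ψ` of `T` puts every point of `S` on the
horizontal circle `{p | p i₁ = c}`: first a shear along `e_{i₀}` makes the abscissae of `S` pairwise
distinct (`exists_rowShift_injOn`, values interpolated continuously), then a shear along `e_{i₁}` by a
continuous function taking the value `s i₁ - c` at the abscissa of each `s` levels the heights.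
[cite: HatcherAT2002, §1.2 Example 1.22 (method; folklore)] -/
theorem exists_homeomorph_forall_apply_eq (hne : i₀ ≠ i₁) (hι : ∀ i, i = i₀ ∨ i = i₁)
    {S : Set (ι → AddCircle (1 : ℝ))} (hS : S.Finite) (c : AddCircle (1 : ℝ)) :
    ∃ Ψ : (ι → AddCircle (1 : ℝ)) ≃ₜ (ι → AddCircle (1 : ℝ)), ∀ s ∈ S, Ψ s i₁ = c := by
  classical
  -- Step 1: a shear along `e_{i₀}` making the abscissae of `S` distinct
  obtain ⟨v, hv⟩ := exists_rowShift_injOn (i₀ := i₀) (i₁ := i₁) hι hS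
  obtain ⟨g₁, hg₁⟩ := exists_continuousMap_addCircle_forall_eq (hS.toFinset.image fun s => s i₁) v
  obtain ⟨Ψ₁, hΨ₁⟩ := exists_homeomorph_shear (ι := ι) hne g₁
  have hΨ₁i₀ : ∀ s ∈ S, Ψ₁ s i₀ = s i₀ - v (s i₁) := fun s hs => by
    rw [hΨ₁, Function.update_self, hg₁ _ (Finset.mem_image_of_mem _ (hS.mem_toFinset.2 hs))]
  have hinj : (Ψ₁ '' S).InjOn fun p => p i₀ := by
    rintro _ ⟨s, hs, rfl⟩ _ ⟨s', hs', rfl⟩ h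
    have h' : s i₀ - v (s i₁) = s' i₀ - v (s' i₁) := by
      rw [← hΨ₁i₀ s hs, ← hΨ₁i₀ s' hs']; exact h
    rw [hv hs hs' h']
  -- Step 2: a shear along `e_{i₁}` levelling the heights
  let f₀ : AddCircle (1 : ℝ) → AddCircle (1 : ℝ) := fun x =>
    if h : ∃ s ∈ Ψ₁ '' S, s i₀ = x then h.choose i₁ - c else 0
  have hf₀ : ∀ s ∈ Ψ₁ '' S, f₀ (s i₀) = s i₁ - c := by
    intro s hs
    have h : ∃ s' ∈ Ψ₁ '' S, s' i₀ = s i₀ := ⟨s, hs, rfl⟩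
    simp only [f₀, dif_pos h]
    rw [hinj h.choose_spec.1 hs h.choose_spec.2]
  obtain ⟨g₂, hg₂⟩ := exists_continuousMap_addCircle_forall_eq
    ((hS.image Ψ₁).toFinset.image fun s => s i₀) f₀
  obtain ⟨Ψ₂, hΨ₂⟩ := exists_homeomorph_shear (ι := ι) hne.symm g₂
  refine ⟨Ψ₁.trans Ψ₂, fun s hs => ?_⟩
  rw [Homeomorph.trans_apply, hΨ₂, Function.update_self,
    hg₂ _ (Finset.mem_image_of_mem _ ((hS.image Ψ₁).mem_toFinset.2 (Set.mem_image_of_mem _ hs))),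
    hf₀ _ (Set.mem_image_of_mem _ hs), sub_sub_cancel]

/-! ### §3 The slit torus `{p | p i₀ ≠ a}` is a punctured disc -/

/-- **Polar coordinates identify the slit torus with the punctured unit disc**:
`{p ∈ T | p i₀ ≠ a} ≃ₜ 𝔻 ∖ {0}`, `p ↦ u(p) · e^{2πi·(p i₁)}` with `u(p) ∈ (0, 1)` the representative
of `p i₀ - a` (two indices `i₀ ≠ i₁`).  [cite: HatcherAT2002, §1.2 Example 1.22 (method; folklore)] -/
theorem nonempty_homeomorph_coordNe_ball_diff (hne : i₀ ≠ i₁) (hι : ∀ i, i = i₀ ∨ i = i₁)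
    (a : AddCircle (1 : ℝ)) :
    Nonempty ({p : ι → AddCircle (1 : ℝ) | p i₀ ≠ a} ≃ₜ
      ↥(Metric.ball (0 : ℂ) 1 \ {0})) := by
  classical
  -- the radius `u(p) ∈ [0, 1)`, positive off the slit, and the angle `ζ(p) ∈ S¹`
  let u : (ι → AddCircle (1 : ℝ)) → ℝ := fun p => (AddCircle.equivIco (1 : ℝ) 0 (p i₀ - a) : ℝ)
  have hu_mem : ∀ p, u p ∈ Ico (0 : ℝ) (0 + 1) := fun p => (AddCircle.equivIco (1 : ℝ) 0 _).2
  have hu_coe : ∀ p, ((u p : ℝ) : AddCircle (1 : ℝ)) = p i₀ - a := fun p => AddCircle.coe_equivIco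
  have hu_ne : ∀ p : ι → AddCircle (1 : ℝ), p i₀ ≠ a → u p ≠ 0 := by
    intro p hp h0
    apply hp
    have := hu_coe p
    rw [h0, AddCircle.coe_zero] at this
    exact (sub_eq_zero.1 this.symm)
  have hu_pos : ∀ p : ι → AddCircle (1 : ℝ), p i₀ ≠ a → 0 < u p := fun p hp =>
    lt_of_le_of_ne (hu_mem p).1 (Ne.symm (hu_ne p hp))
  have hu_cont : ∀ p : ι → AddCircle (1 : ℝ), p i₀ ≠ a → ContinuousAt u p := by
    intro p hp
    have h1 : ContinuousAt (fun q : ι → AddCircle (1 : ℝ) => q i₀ - a) p :=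
      ((continuous_apply i₀).sub continuous_const).continuousAt
    have hpa : p i₀ - a ≠ ((0 : ℝ) : AddCircle (1 : ℝ)) := by
      rw [AddCircle.coe_zero]; exact sub_ne_zero.2 hp
    have h2 : ContinuousAt (fun x : AddCircle (1 : ℝ) => ((AddCircle.equivIco (1 : ℝ) 0 x : ℝ)))
        (p i₀ - a) :=
      continuous_subtype_val.continuousAt.comp (AddCircle.continuousAt_equivIco (1 : ℝ) 0 hpa)
    exact ContinuousAt.comp (f := fun q : ι → AddCircle (1 : ℝ) => q i₀ - a) h2 h1
  let e := AddCircle.homeomorphCircle (one_ne_zero (α := ℝ))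
  let ζ : (ι → AddCircle (1 : ℝ)) → Circle := fun p => e (p i₁)
  have hζ : Continuous ζ := e.continuous.comp (continuous_apply i₁)
  -- the point of the torus with coordinates `(α, β)`
  let mk : AddCircle (1 : ℝ) → AddCircle (1 : ℝ) → (ι → AddCircle (1 : ℝ)) :=
    fun α β i => if i = i₀ then α else β
  have hmk₀ : ∀ α β, mk α β i₀ = α := fun α β => by simp [mk]
  have hmk₁ : ∀ α β, mk α β i₁ = β := fun α β => by simp [mk, hne.symm]
  have hmk : ∀ p : ι → AddCircle (1 : ℝ), mk (p i₀) (p i₁) = p := fun p =>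
    ext_two hι (hmk₀ _ _) (hmk₁ _ _)
  have hmk_cont : Continuous fun q : AddCircle (1 : ℝ) × AddCircle (1 : ℝ) => mk q.1 q.2 := by
    refine continuous_pi fun i => ?_
    by_cases hi : i = i₀
    · simp only [mk, hi, if_true]; exact continuous_fst
    · simp only [mk, hi, if_false]; exact continuous_snd
  -- norms in the target
  have hnorm : ∀ p : ι → AddCircle (1 : ℝ), ‖((u p : ℝ) : ℂ) * (ζ p : ℂ)‖ = u p := fun p => by
    rw [norm_mul, Complex.norm_real, Circle.norm_coe, mul_one, Real.norm_eq_abs,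
      abs_of_nonneg (hu_mem p).1]
  have hmemT : ∀ p : {p : ι → AddCircle (1 : ℝ) | p i₀ ≠ a},
      ((u p.1 : ℝ) : ℂ) * (ζ p.1 : ℂ) ∈ Metric.ball (0 : ℂ) 1 \ {0} := by
    intro p
    refine ⟨?_, ?_⟩
    · rw [Metric.mem_ball, dist_zero_right, hnorm]
      simpa using (hu_mem p.1).2
    · intro h
      have : u p.1 = 0 := by rw [← hnorm p.1, Set.mem_singleton_iff.1 h, norm_zero]
      exact hu_ne p.1 p.2 this
  -- the inverse direction: norm and direction of `z ≠ 0`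
  have hz_ne : ∀ z : ↥(Metric.ball (0 : ℂ) 1 \ {0}), (z : ℂ) ≠ 0 := fun z h => z.2.2 h
  have hz_norm_pos : ∀ z : ↥(Metric.ball (0 : ℂ) 1 \ {0}), 0 < ‖(z : ℂ)‖ := fun z =>
    norm_pos_iff.2 (hz_ne z)
  have hz_norm_lt : ∀ z : ↥(Metric.ball (0 : ℂ) 1 \ {0}), ‖(z : ℂ)‖ < 1 := fun z => by
    have := z.2.1; rwa [Metric.mem_ball, dist_zero_right] at this
  have hdir_mem : ∀ z : ↥(Metric.ball (0 : ℂ) 1 \ {0}),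
      (z : ℂ) / ((‖(z : ℂ)‖ : ℝ) : ℂ) ∈ Submonoid.unitSphere ℂ := by
    intro z
    show (z : ℂ) / ((‖(z : ℂ)‖ : ℝ) : ℂ) ∈ Metric.sphere (0 : ℂ) 1
    rw [mem_sphere_zero_iff_norm, norm_div, Complex.norm_real, Real.norm_eq_abs,
      abs_of_pos (hz_norm_pos z), div_self (hz_norm_pos z).ne']
  let dir : ↥(Metric.ball (0 : ℂ) 1 \ {0}) → Circle := fun z => ⟨_, hdir_mem z⟩
  have hdir_cont : Continuous dir := by
    refine Continuous.subtype_mk ?_ _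
    exact continuous_subtype_val.div (Complex.continuous_ofReal.comp
      (continuous_norm.comp continuous_subtype_val)) fun z => by
        exact_mod_cast (hz_norm_pos z).ne'
  have hinv_ne : ∀ z : ↥(Metric.ball (0 : ℂ) 1 \ {0}),
      mk (a + ((‖(z : ℂ)‖ : ℝ) : AddCircle (1 : ℝ))) (e.symm (dir z)) i₀ ≠ a := by
    intro z h
    rw [hmk₀] at h
    have h0 : ((‖(z : ℂ)‖ : ℝ) : AddCircle (1 : ℝ)) = 0 := by simpa using h
    obtain ⟨n, hn⟩ := (AddCircle.coe_eq_zero_iff (1 : ℝ)).1 h0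
    rw [zsmul_eq_mul, mul_one] at hn
    have h1 : (0 : ℤ) < n := by exact_mod_cast (hn ▸ hz_norm_pos z : (0 : ℝ) < n)
    have h2 : n < (1 : ℤ) := by exact_mod_cast (hn ▸ hz_norm_lt z : (n : ℝ) < 1)
    omega
  refine ⟨{ toFun := fun p => ⟨((u p.1 : ℝ) : ℂ) * (ζ p.1 : ℂ), hmemT p⟩
            invFun := fun z => ⟨mk (a + ((‖(z : ℂ)‖ : ℝ) : AddCircle (1 : ℝ))) (e.symm (dir z)),
              hinv_ne z⟩
            left_inv := fun p => ?_
            right_inv := fun z => ?_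
            continuous_toFun := ?_
            continuous_invFun := ?_ }⟩
  · -- left inverse
    apply Subtype.ext
    change mk (a + ((‖((u p.1 : ℝ) : ℂ) * (ζ p.1 : ℂ)‖ : ℝ) : AddCircle (1 : ℝ))) (e.symm (dir _)) = p.1
    have h1 : a + ((‖((u p.1 : ℝ) : ℂ) * (ζ p.1 : ℂ)‖ : ℝ) : AddCircle (1 : ℝ)) = p.1 i₀ := by
      rw [hnorm, hu_coe, add_sub_cancel]
    have h2 : dir ⟨((u p.1 : ℝ) : ℂ) * (ζ p.1 : ℂ), hmemT p⟩ = ζ p.1 := by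
      apply Subtype.ext
      change ((u p.1 : ℝ) : ℂ) * (ζ p.1 : ℂ) / ((‖((u p.1 : ℝ) : ℂ) * (ζ p.1 : ℂ)‖ : ℝ) : ℂ) = (ζ p.1 : ℂ)
      rw [hnorm, mul_div_cancel_left₀ _ (by exact_mod_cast hu_ne p.1 p.2)]
    rw [h1, h2]
    change mk (p.1 i₀) (e.symm (e (p.1 i₁))) = p.1
    rw [e.symm_apply_apply, hmk]
  · -- right inverse
    apply Subtype.ext
    set α : AddCircle (1 : ℝ) := a + ((‖(z : ℂ)‖ : ℝ) : AddCircle (1 : ℝ)) with hα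
    set β : AddCircle (1 : ℝ) := e.symm (dir z) with hβ
    change ((u (mk α β) : ℝ) : ℂ) * (ζ (mk α β) : ℂ) = (z : ℂ)
    have h1 : u (mk α β) = ‖(z : ℂ)‖ := by
      change ((AddCircle.equivIco (1 : ℝ) 0 (mk α β i₀ - a) : ℝ)) = ‖(z : ℂ)‖
      rw [hmk₀, hα, add_sub_cancel_left,
        AddCircle.equivIco_coe_eq ⟨(hz_norm_pos z).le, by simpa using hz_norm_lt z⟩]
    have h2 : ζ (mk α β) = dir z := by
      change e (mk α β i₁) = dir z
      rw [hmk₁, hβ, e.apply_symm_apply]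
    rw [h1, h2]
    change ((‖(z : ℂ)‖ : ℝ) : ℂ) * ((z : ℂ) / ((‖(z : ℂ)‖ : ℝ) : ℂ)) = (z : ℂ)
    rw [mul_div_cancel₀]
    exact_mod_cast (hz_norm_pos z).ne'
  · -- continuity
    refine Continuous.subtype_mk ?_ _
    refine Continuous.mul ?_ (continuous_subtype_val.comp (hζ.comp continuous_subtype_val))
    refine Complex.continuous_ofReal.comp ?_
    exact continuous_iff_continuousAt.2 fun p =>
      (hu_cont p.1 p.2).comp continuous_subtype_val.continuousAt
  · -- continuity of the inverse
    refine Continuous.subtype_mk ?_ _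
    have hα : Continuous fun z : ↥(Metric.ball (0 : ℂ) 1 \ {0}) =>
        a + ((‖(z : ℂ)‖ : ℝ) : AddCircle (1 : ℝ)) :=
      continuous_const.add ((AddCircle.continuous_mk' (1 : ℝ)).comp
        (continuous_norm.comp continuous_subtype_val))
    have hβ : Continuous fun z : ↥(Metric.ball (0 : ℂ) 1 \ {0}) => e.symm (dir z) :=
      e.symm.continuous.comp hdir_cont
    exact hmk_cont.comp (hα.prodMk hβ)

end TorusMinusFinite

end Literature.AlgebraicTopology.FundamentalGroup

end
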